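import Summits.BirchSwinnertonDyer.BirchSwinnertonDyer.Theorems.PrintX6BSTWByName
import Summits.BirchSwinnertonDyer.Rank1Residual.Supersingular.KobayashiMainConjectureX6BSTWCellChainThree
import HarnessLib

/-!
# Route `PrintX6` — the residual crux `EisensteinHalfAtThree` BY NAME from the bsd-ssimc CELL-chain binder at `p = 3`
# (cell `bsd-print-x6`, seat p1, lane «BSTW Thm 1.3/1.5 BY NAME»; road C3 = road S of `PrintX6BSTWByName.lean` with the
# `p = 3` preprint tier replaced by the WEAKER cell-chain provenance binder)

WHAT THIS FILE DOES. The sibling cell `bsd-ssimc` landed the `p = 3` CELL-CHAIN provenance binder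
`Supersingular.BSTW2024_lowerDivisibility_atThreeS_CELL` (module
`Summits.BirchSwinnertonDyer.Rank1Residual.Supersingular.KobayashiMainConjectureX6BSTWCellChainThree`; names agreed by
both planners 2026-08-27T17:15:10Z; CITE-ONLY on this route): for `p = 3`, `W` semistable, good supersingular at `3`
with `a_3 = 0` and a scope witness, Kobayashi's EISENSTEIN (lower) divisibility for every sign — provenance «claim:
bsd-ssimc cell chain MEMO-11/12/14 — status: in-cell-refereed» (an Ohta-free in-cell reading of the preprint
arXiv:2409.01350 at `p = 3`; NOT refereed print). It is WEAKER than the `p = 3` S-scoped preprint tier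
`BurungaleSkinnerTianWan2024_thm13_scopedAtThreeS_OPEN` (`lowerDivisibility_atThreeS_CELL_of_thm13_scopedAtThreeS_OPEN`,
same module) and is exactly what the route's `p = 3` residual consumes. Here:
* §1 `eisensteinHalfAtThree_of_lowerDivisibility_atThreeS_CELL (hPub) (hLL) (h3c) : EisensteinHalfAtThree` — the
  residual crux 3 (stmt-BirchSwinnertonDyer-20285) BY NAME on road C3, via the stub-1-at-3 shape
  `signedLowerDivisibilityAtThree_of_lowerDivisibility_atThreeS_CELL` (the binder APPLIED AT THE LEAF: semistable =
  `hX.2.1`, supersingular = `hX.1`, `a_3 = 0` = `h4_of_classX6`, scope datum = `hasAuxWitness_of_leaf` from the inputs'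
  modularity + Diamond 1995 / Ribet 1990) and ty2's descent adapter
  `X6RankZero.eisensteinHalfAtThree_of_forall_kobayashiLowerDivisibility`;
* §2 the leaf `WAllCornerX6r0` on roads S (p ≥ 5) + C3 (p = 3): `wallCornerX6r0_of_printX6_tiersS_C3`,
  `wallCornerX6r0_of_publishedInputsX6_tiersS_C3` (upper half discharged by seat p2's Kobayashi-4.1 chain, as in
  `wallCornerX6r0_of_publishedInputsX6_tiersS_S3`).

HONEST FRAMING. Every theorem here is CONDITIONAL (`conditional-result`): hypotheses = the CELL-chain binder (not
refereed print), the route's published inputs `PublishedInputsX6` BY NAME, Diamond 1995 / Ribet 1990 level-lowering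
`diamond1995_refinedSerre` for the S-scope datum, and in §2 the `p ≥ 5` S-scoped preprint tier. (The road-S-at-3
closer of record `eisensteinHalfAtThree_of_thm13_scopedAtThreeS_OPEN`, p541401, is §1 precomposed with
`lowerDivisibility_atThreeS_CELL_of_thm13_scopedAtThreeS_OPEN` — road S at 3 ⊆ road C3; not restated.) The crux
`EisensteinHalfAtThree` (stmt-BirchSwinnertonDyer-20285) stays OPEN, the declared residual of the route; nothing is
discharged, no `def`, no named fact, no restatement. PARTITION: 0 cells; BEYOND-PRINT THEOREM: NO.
-/

set_option autoImplicit false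
set_option linter.dupNamespace false

noncomputable section

open scoped Classical


open WeierstrassCurve Literature.NumberTheory.EllipticCurves
  Literature.NumberTheory.EllipticCurves.Rank1Residual
  Literature.NumberTheory.EllipticCurves.BurungaleSkinnerTianWan2024
  Summit.BirchSwinnertonDyer.Rank1Residual.Supersingular
  Summit.BirchSwinnertonDyer.BirchSwinnertonDyer.Theses.PrintX6

namespace Summit.BirchSwinnertonDyer.BirchSwinnertonDyer.Theorems.PrintX6

/-! ### §1 Road C3 — the `p = 3` residual BY NAME from the CELL-chain binder -/

/-- **Stub-1-at-3 shape MODULO the CELL-tier binder**: at every non-CM X6 ∧ r_an = 0 pair with `p = 3`, Kobayashi's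
lower (Eisenstein) divisibility for the sign `+1` — the CELL binder APPLIED AT THE LEAF ("semistable" = `hX.2.1`,
"supersingular" = `hX.1`, "`a_3 = 0`" = `h4_of_classX6`, scope datum = `hasAuxWitness_of_leaf` from the inputs'
modularity + Diamond/Ribet `hLL`). CONDITIONAL; nothing discharged.
Provenance of `h3c`: «claim: bsd-ssimc cell chain MEMO-11/12/14 — status: in-cell-refereed».
[claim: BurungaleSkinnerTianWan2024, status: under-review] [cite: Kobayashi2003, Conjecture (Main Conjecture) (p. 2)]
[cite: Ribet1990, Thm. 1.1] -/
theorem signedLowerDivisibilityAtThree_of_lowerDivisibility_atThreeS_CELL (hPub : PublishedInputsX6)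
    (hLL : Literature.NumberTheory.Automorphic.diamond1995_refinedSerre)
    (h3c : BSTW2024_lowerDivisibility_atThreeS_CELL) :
    ∀ (W : WeierstrassCurve ℚ) [W.IsElliptic] [W.IsGloballyMinimal] (p : ℕ) [Fact p.Prime],
      ¬ W.HasCM → p = 3 → Literature.NumberTheory.EllipticCurves.Rank1Residual.ClassX6 W p →
      W.analyticRank = 0 →
      ∃ ε : ℤˣ, Summit.BirchSwinnertonDyer.Rank1Residual.Supersingular.KobayashiLowerDivisibility W p ε := by
  intro W _ _ p _ _ h3 hX _
  exact ⟨1, h3c W p h3 hX.2.1 hX.1 (h4_of_classX6 W p hX h3) (hasAuxWitness_of_leaf hPub hLL W p (by omega) hX) 1⟩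

/-- **Residual crux 3 `EisensteinHalfAtThree` (stmt-BirchSwinnertonDyer-20285) BY NAME from the CELL-tier binder**:
`PublishedInputsX6 → diamond1995_refinedSerre → BSTW2024_lowerDivisibility_atThreeS_CELL → EisensteinHalfAtThree`, via
the ty2 interface's descent adapter `X6RankZero.eisensteinHalfAtThree_of_forall_kobayashiLowerDivisibility` (Kobayashi
Thm. 1.2, Kim Cor. 3.15, Pollack, modularity, GZK = conjuncts 1, 3, 7, 8, 9 of the inputs). The item's type VERBATIM as
conclusion. CONDITIONAL on the CELL-tier binder (not refereed print); the crux stays OPEN; not bookable.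
Provenance of `h3c`: «claim: bsd-ssimc cell chain MEMO-11/12/14 — status: in-cell-refereed».
[claim: BurungaleSkinnerTianWan2024, status: under-review] [cite: Kobayashi2003, Thm. 1.2 and Conjecture (p. 2)]
[cite: BDKim2013, Cor. 3.15 (p. 199)] [cite: Ribet1990, Thm. 1.1] [cite: Miller2011LMS, Def. 1.1] -/
theorem eisensteinHalfAtThree_of_lowerDivisibility_atThreeS_CELL (hPub : PublishedInputsX6)
    (hLL : Literature.NumberTheory.Automorphic.diamond1995_refinedSerre)
    (h3c : BSTW2024_lowerDivisibility_atThreeS_CELL) : EisensteinHalfAtThree := by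
  have ⟨h12, _, hKim, _, _, _, hmodP, hmod, hGZK⟩ := hPub
  exact X6RankZero.eisensteinHalfAtThree_of_forall_kobayashiLowerDivisibility h12 hKim hmodP hmod hGZK
    fun W _ _ p _ h3 hX h0 ↦
      signedLowerDivisibilityAtThree_of_lowerDivisibility_atThreeS_CELL hPub hLL h3c W p (ClassX6.not_hasCM W hX)
        h3 hX h0

/-! ### §2 The leaf on roads S (p ≥ 5) + C3 (p = 3) -/

/-- **The leaf in the PLAN's turnkey shape with the `p = 3` tier replaced by the CELL-chain binder**:
`PublishedInputsX6 → UpperHalfX6 → diamond1995_refinedSerre → thm13_scopedS_OPEN → BSTW2024_lowerDivisibility_atThreeS_CELL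
→ WAllCornerX6r0`, glued by ty2's assembly kernel form `X6RankZero.wallCornerX6r0_of_upper_of_eisensteinHalves` exactly as
`wallCornerX6r0_of_printX6_tiersS_S3`. Binders: ONE preprint tier (p ≥ 5, S-scoped) + the cell-chain binder (p = 3,
«claim: bsd-ssimc cell chain MEMO-11/12/14 — status: in-cell-refereed») + PUB inputs. CONDITIONAL; 0 cells booked.
[claim: BurungaleSkinnerTianWan2024, status: under-review] [cite: Kobayashi2003, Thm. 1.2, Thm. 4.1]
[cite: BDKim2013, Cor. 3.15 (p. 199)] [cite: Ribet1990, Thm. 1.1] [cite: Miller2011LMS, §1 and Def. 1.1] -/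
theorem wallCornerX6r0_of_printX6_tiersS_C3 (hPub : PublishedInputsX6) (hU : UpperHalfX6)
    (hLL : Literature.NumberTheory.Automorphic.diamond1995_refinedSerre)
    (h5t : BurungaleSkinnerTianWan2024_thm13_scopedS_OPEN)
    (h3c : BSTW2024_lowerDivisibility_atThreeS_CELL) : Summit.BirchSwinnertonDyer.WAllCornerX6r0 :=
  X6RankZero.wallCornerX6r0_of_upper_of_eisensteinHalves hPub.2.2.2.2.2.2.2.2 (hU hPub)
    (eisensteinHalfFiveLe_of_thm13_scopedS_OPEN hPub hLL h5t)
    (eisensteinHalfAtThree_of_lowerDivisibility_atThreeS_CELL hPub hLL h3c)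

/-- **The leaf on roads S + C3 from the inputs ALONE** (upper half discharged in the kernel by seat p2's
route-independent chain `X6.missingUpperBoundAt_rankZero_of_thm41`: Kobayashi Thm. 4.1 (b) + Thm. 1.2 + Kim Cor. 3.15 +
period units; no Wuthrich Prop. 21): `PublishedInputsX6 → diamond1995_refinedSerre → thm13_scopedS_OPEN →
BSTW2024_lowerDivisibility_atThreeS_CELL → WAllCornerX6r0`. Versus `wallCornerX6r0_of_publishedInputsX6_tiersS_S3`: the
`p = 3` preprint tier is replaced by the weaker cell-chain binder; everything else identical. CONDITIONAL; 0 cells booked.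
[claim: BurungaleSkinnerTianWan2024, status: under-review] [cite: Kobayashi2003, Thm. 1.2, Thm. 4.1 (p. 8)]
[cite: BDKim2013, Cor. 3.15 (p. 199)] [cite: Ribet1990, Thm. 1.1] [cite: Miller2011LMS, §1 and Def. 1.1] -/
theorem wallCornerX6r0_of_publishedInputsX6_tiersS_C3 (hPub : PublishedInputsX6)
    (hLL : Literature.NumberTheory.Automorphic.diamond1995_refinedSerre)
    (h5t : BurungaleSkinnerTianWan2024_thm13_scopedS_OPEN)
    (h3c : BSTW2024_lowerDivisibility_atThreeS_CELL) : Summit.BirchSwinnertonDyer.WAllCornerX6r0 := by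
  have ⟨h12, h41, hKim, hper, hper3, _, hmodP, hmod, hGZK⟩ := hPub
  exact wallCornerX6r0_of_printX6_tiersS_C3 hPub
    (fun _ W _ _ p _ hp hX h0 ↦
      X6.missingUpperBoundAt_rankZero_of_thm41 W p h41 h12 hKim hper hper3 hmodP hmod hGZK hp hX h0)
    hLL h5t h3c

end Summit.BirchSwinnertonDyer.BirchSwinnertonDyer.Theorems.PrintX6

end
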